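import Summits.BirchSwinnertonDyer.BirchSwinnertonDyer.Theorems.EisensteinPrimesKummerTorsionH1
import Summits.BirchSwinnertonDyer.BirchSwinnertonDyer.Theorems.EisensteinPrimesCharLocalInertiaFrobenius
import Summits.BirchSwinnertonDyer.BirchSwinnertonDyer.Theorems.EisensteinPrimesCharLocalLemmas
import Summits.BirchSwinnertonDyer.BirchSwinnertonDyer.Theorems.UniversalToricDescentUnramifiedLocalCount
import Summits.BirchSwinnertonDyer.BirchSwinnertonDyer.Theorems.UniversalToricDescentLocalH1DivisibleCurve
import Summits.BirchSwinnertonDyer.Rank1Residual.X2.GreenbergSelmerCountNonsplit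
import HarnessLib

/-!
# KY / CGLS Lemma 1.1.1 per place of `K_∞`, LOWER-bound half (the tame class): at `v ∤ p` finitely
# decomposed in a `ℤ_p`-extension, `θ` unramified with `θ(Frob_v) ≡ Nv (mod 𝔭)`:
# `#H¹(K_{∞,w}, (F/𝒪)(θ))[p] = p`, `H¹(K_{∞,w}, (F/𝒪)(θ))` is `p`-divisible, `corank_{ℤ_p} = 1`

Cell `bsd-eis` (home `run/shared/lean/pub/bsd-eis/`), seat `bsd-line-x1-p1-w2` (gen 1; D-0154 width
seat on crux 2 `GoodLatticeBDPValue` = stmt-BirchSwinnertonDyer-19032, line `halves` v16, stub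
`stub_imprimCorank` = `KellerYin2024.prop125_residualPair_unrSelmer_corank_ge`). LEAD verdict v3.1
§3 item (vii): the `≥` inequality of the `S`-relaxation corank identity needs, besides the
surjectivity of the global-to-local map (road (A) Greenberg 2016 Prop. 2.6.3 / road (B) PW 2011
Prop. A.2), the LOCAL lower bound `corank_{ℤ_p} H¹(K_{∞,η}, (F/𝒪)(θ)) ≥ 𝟙[θ(Frob_w) ≡ Nw (mod 𝔭)]`
per place `η ∣ w` of `K_∞` (Keller–Yin arXiv:2402.12781v2 Lemma 1.1.1 = CGLS Lemma 1.1.1: "`H¹(K_w,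
M_θ)^∨` is `Λ`-torsion with characteristic ideal `(𝒫_w(θ))`", `λ(𝒫_w(θ)) = [Γ:Γ_w]·𝟙[…]`; the
UPPER bound is the tree's `CharLocalInertiaFrobenius.zpCorank_le_ite_of_forall_exists`, p609213).
This file proves the lower bound — indeed the VALUE — in the local currency
`Hi = Gal(K̄_v/K_{∞,w}) = localSubgroup (ker κ) K_v ≤ Γ_{K_v}` of the tree's Greenberg–Vatsal
Prop. (2.4) files (route UniversalToricDescent), with `Γ_{K_v}` acting on `M = (F/𝒪)(θ) = charModule
∅ θ` through the chosen embedding (`absGaloisRestrict`, a local instance of each proof):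

* §1 `exists_invariant_nsmul_eq_charModule` — for `θ^{p−1} = 1` the invariants of `M` under ANY
  set of Galois elements are `p`-divisible inside the invariants (they are `M` or `0`: a value
  `θ(σ) ≠ 1` is a non-trivial `(p−1)`-st root of unity, so `θ(σ) − 1` is a unit);
  `sub_mem_maximalIdeal_of_frobActsAsNormAt` — `FrobActsAsNormAt ∅ θ v` read on a local Frobenius:
  `θ(res φ) − q_v ∈ 𝔪_{ℤ_p}` (converse of the tree's `frobActsAsNormAt_of_sub_mem_maximalIdeal`).
* §2 **`natCard_pTorsion_subgroupH1_localSubgroup_charModule_eq`** — at `v ∤ p` NOT split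
  completely in `K_∞`, `θ^{p−1} = 1`, `FrobActsAsNormAt ∅ θ v`:
  **`#{x ∈ H¹(Hi, M) : p • x = 0} = p`**. Chain: Kummer `= #H¹(Hi, M[p])`
  (`KummerTorsionH1.natCard_nsmul_eq_zero_discreteH1_eq`, §1) · unramified count
  `= #{b ∈ M[p] : φ^{p^R} b = q^{p^R} b}` (UTD `exists_forall_natCard_subgroupH1_localSubgroup_eq`,
  `M[p]` unramified as `θ` is) · `= #M[p] = p` (both sides act as the integers `appr θ(φ) 1 ≡ q_v`).
* §3 `exists_nsmul_eq_subgroupH1_localSubgroup_charModule` — **`H¹(Hi, M)` is `p`-divisible**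
  (UTD `exists_nsmul_eq_subgroupH1_localSubgroup`: `M ≅ ℚ_p/ℤ_p` is `p`-primary, divisible, with
  finite layers); **`zpCorank_subgroupH1_localSubgroup_charModule_eq_one`** — hence
  **`corank_{ℤ_p} H¹(Hi, M) = 1`** (`natCard_torsionBy_eq_pow_zpCorank_of_divisible`).

The transport to the global currency `H¹(ker κ ⊓ D_v, M)` (= PW's `localH1`, Greenberg's `awayKer`
target) is the sequel file. HONEST FRAMING: tool theorems only (no definition, no named fact, no
`sorry`); closes nothing by itself (`--supports stmt-BirchSwinnertonDyer-19032`); BSD / Mazur's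
main conjecture / IMC is proved for no curve by this file.

References: Keller–Yin arXiv:2402.12781v2 Lemma 1.1.1 (TeX L455–462); Castella–Grossi–Lee–Skinner,
Invent. Math. 227 (2022) Lemma 1.1.1; Greenberg–Vatsal, Invent. Math. 142 (2000) §2 Prop. (2.4)
(p. 22); Greenberg, LNM 1716 §3 Lemma 3.3; Serre, *Galois Cohomology* I §2.2.
-/

-- `Summit.BirchSwinnertonDyer.BirchSwinnertonDyer.…`: summit and sub-problem share a name (D-0017 layout).
set_option linter.dupNamespace false
set_option autoImplicit false

noncomputable section

open scoped Classical AddSubgroup Pointwise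

open CategoryTheory Function Filter Polynomial NumberField IsDedekindDomain Field ValuativeRel
open Literature.NumberTheory.EllipticCurves Literature.NumberTheory.EllipticCurves.GreenbergSelmer
  Literature.NumberTheory.GaloisRepresentations
  Literature.NumberTheory.GaloisRepresentations.IsNonarchimedeanLocalField
  Literature.NumberTheory.EllipticCurves.KellerYin2024 Literature.NumberTheory.IwasawaTheory
  IsDedekindDomain.HeightOneSpectrum
  Summit.BirchSwinnertonDyer.Rank1Residual
  Summit.BirchSwinnertonDyer.Rank1Residual.X2.NonPrimitiveQuotientCorank
  Summit.BirchSwinnertonDyer.Rank1Residual.X2.GreenbergSelmerCountNonsplit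
  Summit.BirchSwinnertonDyer.Rank1Residual.Iwasawa.NonsplitTower
  Summit.BirchSwinnertonDyer.BirchSwinnertonDyer.Theorems.CharLocalInertiaBounds
  Summit.BirchSwinnertonDyer.BirchSwinnertonDyer.Theorems.CharLocalInertiaFrobenius
  Summit.BirchSwinnertonDyer.BirchSwinnertonDyer.Theorems.UnrSelmerQuotientTorsionFiniteChar
  Summit.BirchSwinnertonDyer.BirchSwinnertonDyer.Theorems.IwasawaTwoVariable
  Summit.BirchSwinnertonDyer.BirchSwinnertonDyer.Theorems.UniversalToricDescentUnramifiedLocalCount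
  Summit.BirchSwinnertonDyer.BirchSwinnertonDyer.Theorems.UniversalToricDescentLocalH1Divisible
  Summit.BirchSwinnertonDyer.BirchSwinnertonDyer.Theorems.KummerTorsionH1

namespace Summit.BirchSwinnertonDyer.BirchSwinnertonDyer.Theorems.CharLocalTameCount

variable {K : Type} [Field K] [NumberField K] {p : ℕ} [hp : Fact p.Prime]
  (θ : FramedGaloisRep K (padicCoeffIntegers (∅ : Set (PadicAlgCl p))) 1)
  {v : HeightOneSpectrum (𝓞 K)}

/-! ## §1 Invariants of `(F/𝒪)(θ)` are `p`-divisible; `FrobActsAsNormAt` on a local Frobenius -/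

omit hp in
/-- `a • b = c • b` for `p • b = 0` and `a ≡ c (mod p)`. [folklore] -/
theorem nsmul_eq_nsmul_of_modEq [Fact p.Prime] {B : Type*} [AddCommGroup B] {b : B} (hb : p • b = 0)
    {a c : ℕ} (h : a ≡ c [MOD p]) : a • b = c • b := by
  have key : ∀ n : ℕ, n • b = (n % p) • b := fun n ↦ by
    conv_lhs => rw [← Nat.mod_add_div n p]
    rw [add_smul, mul_comm, mul_smul, hb, smul_zero, add_zero]
  rw [key a, key c]
  exact congrArg (· • b) h

omit [NumberField K] in
/-- **The invariants of `(F/𝒪)(θ)` under any set `T` of Galois elements are `p`-divisible INSIDE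
the invariants**, for `θ^{p−1} = 1`: either `unitChar θ = 1` on `T` (then every element is
invariant and `M ≅ ℚ_p/ℤ_p` is divisible), or some `σ ∈ T` has `θ(σ) ≠ 1`, a non-trivial
`(p−1)`-st root of unity, so `θ(σ) − 1` is a unit and the only invariant is `0`. This is the
hypothesis `hinv` of `KummerTorsionH1.natCard_nsmul_eq_zero_discreteH1_eq`.
[cite: KellerYin2024, §1.1 (arXiv:2402.12781v2 TeX L441–449)] -/
theorem exists_invariant_nsmul_eq_charModule
    (hθ : ∀ σ : absoluteGaloisGroup K, θ σ ^ (p - 1) = 1) (T : Set (absoluteGaloisGroup K))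
    (m : charModule (∅ : Set (PadicAlgCl p)) θ) (hm : ∀ σ ∈ T, σ • m = m) :
    ∃ m' : charModule (∅ : Set (PadicAlgCl p)) θ, (∀ σ ∈ T, σ • m' = m') ∧ p • m' = m := by
  by_cases hT : ∀ σ ∈ T, unitChar θ σ = 1
  · obtain ⟨m', hm'⟩ := exists_nsmul_eq_charModule θ m
    exact ⟨m', fun σ hσ ↦ CharLocalVanishing.smul_eq_self_of_unitChar_eq_one θ (hT σ hσ) m', hm'⟩
  · push Not at hT
    obtain ⟨σ, hσT, hσ⟩ := hT
    -- `θ(σ) − 1` is a unit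
    have hu : IsUnit (((unitChar θ σ : ℤ_[p]ˣ) : ℤ_[p]) - 1) := by
      by_contra hnu
      apply hσ
      have hmem : ((unitChar θ σ : ℤ_[p]ˣ) : ℤ_[p]) - 1 ∈ IsLocalRing.maximalIdeal ℤ_[p] :=
        (IsLocalRing.mem_maximalIdeal _).mpr hnu
      have hp1 : ¬ p ∣ (p - 1) := fun h ↦ by
        have h2 := hp.out.two_le
        have := Nat.le_of_dvd (Nat.sub_pos_of_lt hp.out.one_lt) h
        omega
      exact Units.ext (padicInt_eq_one_of_pow_eq_one_of_sub_one_mem hp1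
        (by rw [← Units.val_pow_eq_pow_val, unitChar_pow_eq_one θ hθ σ, Units.val_one]) hmem)
    -- so `m = 0`
    have hm0 : m = 0 := by
      have h := congrArg (charModuleEquiv θ) (hm σ hσT)
      rw [charModuleEquiv_galois_smul] at h
      have h0 := CharLocalVanishing.eq_zero_of_unit_sub_smul_eq (c := 1) hu (by rw [one_smul]; exact h)
      exact (charModuleEquiv θ).map_eq_zero_iff.mp h0
    exact ⟨0, fun _ _ ↦ smul_zero _, by rw [hm0, smul_zero]⟩

/-- **`FrobActsAsNormAt ∅ θ v` on a local Frobenius: `θ(res φ) − q_v ∈ 𝔪_{ℤ_p}`** for every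
`φ ∈ Γ_{K_v}` with `IsFrobPow φ 1` (the entry `θ(res φ)₀₀ = e(unitChar θ (res φ))` is the
Frobenius value by `hasFrobCharpolyAt_iff_of_rank_one`, and `e : ℤ_p ≅ 𝒪_{ℚ_p(∅)}` is an
isometry into `ℚ̄_p`). Converse of `CharLocalInertiaFrobenius.frobActsAsNormAt_of_sub_mem_maximalIdeal`.
[cite: KellerYin2024, Lemma 1.1.1 (arXiv:2402.12781v2 TeX L455–462)] -/
theorem sub_mem_maximalIdeal_of_frobActsAsNormAt
    (hF : FrobActsAsNormAt (∅ : Set (PadicAlgCl p)) θ v)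
    {φ : absoluteGaloisGroup (v.adicCompletion K)} (hφ : IsFrobPow φ 1) :
    ((unitChar θ (absGaloisRestrict K (v.adicCompletion K) φ) : ℤ_[p]ˣ) : ℤ_[p]) -
      (residueFieldCard (v.adicCompletion K) : ℤ_[p]) ∈ IsLocalRing.maximalIdeal ℤ_[p] := by
  obtain ⟨_, a, hchar, hnorm⟩ := hF
  have hq : residueFieldCard (v.adicCompletion K) = Nat.card (𝓞 K ⧸ v.asIdeal) := by
    rw [Literature.NumberTheory.Automorphic.residueFieldCard_adicCompletion_eq,
      v.residueCard_eq_card_quotient]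
  have hfrob : IsArithFrobAt (𝓞 K) (absGaloisRestrict K (v.adicCompletion K) φ)
      (adicCompletionPrime K v) :=
    (isArithFrobAt_absGaloisRestrict_adicCompletionPrime_iff K v hq φ).mpr
      (isFrobPow_one_iff_isAbsArithFrob_holds.mp hφ)
  have ha : (((θ (absGaloisRestrict K (v.adicCompletion K) φ) :
      GL (Fin 1) (padicCoeffIntegers (∅ : Set (PadicAlgCl p)))) :
        Matrix (Fin 1) (Fin 1) (padicCoeffIntegers (∅ : Set (PadicAlgCl p)))) 0 0) = a :=
    (FramedGaloisRep.hasFrobCharpolyAt_iff_of_rank_one θ v a).mp hchar _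
      (adicCompletionPrime_mem_primesAbove K v) _ hfrob
  have hentry : a = padicIntEquivCoeffIntegersEmpty p
      ((unitChar θ (absGaloisRestrict K (v.adicCompletion K) φ) : ℤ_[p]ˣ) : ℤ_[p]) := by
    rw [padicIntEquiv_unitChar]; exact ha.symm
  have hN : (v.asIdeal.absNorm : PadicAlgCl p) =
      algebraMap ℚ_[p] (PadicAlgCl p)
        (((residueFieldCard (v.adicCompletion K) : ℤ_[p]) : ℚ_[p])) := by
    rw [PadicInt.coe_natCast, map_natCast, hq, Ideal.absNorm_apply, Submodule.cardQuot_apply]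
  rw [hentry, coe_padicIntEquivCoeffIntegersEmpty, hN, ← map_sub, norm_algebraMap',
    ← PadicInt.coe_sub] at hnorm
  change ‖((unitChar θ (absGaloisRestrict K (v.adicCompletion K) φ) : ℤ_[p]ˣ) : ℤ_[p]) -
    (residueFieldCard (v.adicCompletion K) : ℤ_[p])‖ < 1 at hnorm
  rwa [IsLocalRing.mem_maximalIdeal, PadicInt.mem_nonunits]

/-! ## §2 `#H¹(Gal(K̄_v/K_{∞,w}), (F/𝒪)(θ))[p] = p` under `FrobActsAsNormAt` -/

/-- **`#{x ∈ H¹(Hi, (F/𝒪)(θ)) : p • x = 0} = p`** for `Hi = Gal(K̄_v/K_{∞,w}) = localSubgroup (ker κ) K_v`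
(any `ℤ_p`-extension `κ`), `v ∤ p` not split completely in `K_∞` (`hns`), `θ^{p−1} = 1`, and
`FrobActsAsNormAt ∅ θ v` (`θ` unramified at `v`, `θ(Frob_v) ≡ q_v (mod 𝔭)`); the local action of
`Γ_{K_v}` on `(F/𝒪)(θ)` is through `absGaloisRestrict`. Kummer (`natCard_nsmul_eq_zero_discreteH1_eq`,
invariants divisible by §1) reduces to `#H¹(Hi, M[p])`, which the unramified count
(`exists_forall_natCard_subgroupH1_localSubgroup_eq`) evaluates as `#{b ∈ M[p] : φ^{p^R} b = q^{p^R} b}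
= #M[p] = p`, both sides acting on `M[p]` as the congruent integers `appr θ(φ) 1 ≡ q_v (mod p)`.
The inertia side of KY Lemma 1.1.1 ("`H¹(K_w, M_θ)^∨` has characteristic ideal `(𝒫_w(θ))`") in the
case `θ(Frob_w) ≡ ℓ`. [cite: KellerYin2024, Lemma 1.1.1 (arXiv:2402.12781v2 TeX L455–462)]
[cite: GreenbergVatsal2000, §2 Prop. (2.4) (p. 22)] [cite: CastellaGrossiLeeSkinner2022, Lemma 1.1.1] -/
theorem natCard_pTorsion_subgroupH1_localSubgroup_charModule_eq (κ : ZpExtension K p)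
    (hθ : ∀ σ : absoluteGaloisGroup K, θ σ ^ (p - 1) = 1) (hpv : (p : 𝓞 K) ∉ v.asIdeal)
    (hns : ∃ σ : absoluteGaloisGroup (v.adicCompletion K),
      σ ∉ localSubgroup κ.kerSubgroup (v.adicCompletion K))
    (hF : FrobActsAsNormAt (∅ : Set (PadicAlgCl p)) θ v) :
    letI : DistribMulAction (absoluteGaloisGroup (v.adicCompletion K))
        (charModule (∅ : Set (PadicAlgCl p)) θ) :=
      DistribMulAction.compHom _ (absGaloisRestrict K (v.adicCompletion K)).toMonoidHom
    Nat.card {x : Literature.NumberTheory.EllipticCurves.subgroupH1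
        (localSubgroup κ.kerSubgroup (v.adicCompletion K)) (charModule (∅ : Set (PadicAlgCl p)) θ) //
      p • x = 0} = p := by
  set M := charModule (∅ : Set (PadicAlgCl p)) θ with hM
  letI inst : DistribMulAction (absoluteGaloisGroup (v.adicCompletion K)) M :=
    DistribMulAction.compHom _ (absGaloisRestrict K (v.adicCompletion K)).toMonoidHom
  -- notation
  let Fv := v.adicCompletion K
  let G : Type := absoluteGaloisGroup Fv
  let Hi : Subgroup G := localSubgroup κ.kerSubgroup Fv
  let r : G →ₜ* absoluteGaloisGroup K := absGaloisRestrict K Fv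
  let B : Type := ↥(M[(p : ℤ)])
  have hsmul : ∀ (g : G) (m : M), g • m = r g • m := fun _ _ ↦ rfl
  -- continuity of the orbit maps
  have hstab := GreenbergSelmer.isOpen_stabilizer_cofree (p := p) (∅ : Set (PadicAlgCl p)) θ
  have hcontK : ∀ m : M, Continuous fun σ : absoluteGaloisGroup K ↦ σ • m := fun m ↦
    continuous_smul_of_isOpen_stabilizer m (hstab m)
  have hcont : ∀ m : M, Continuous fun g : G ↦ g • m := fun m ↦
    (hcontK m).comp r.continuous_toFun
  have hcontHi : ∀ m : M, Continuous fun g : Hi ↦ g • m := fun m ↦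
    (hcont m).comp continuous_subtype_val
  -- Step 1 (Kummer): `#{x : p x = 0} = #H¹(Hi, M[p])`
  have hinv : ∀ m : M, (∀ g : Hi, g • m = m) →
      ∃ m' : M, (∀ g : Hi, g • m' = m') ∧ p • m' = m := by
    intro m hm
    obtain ⟨m', hm', hpm'⟩ := exists_invariant_nsmul_eq_charModule θ hθ
      (Set.range fun g : Hi ↦ r g) m (by rintro _ ⟨g, rfl⟩; exact hm g)
    exact ⟨m', fun g ↦ hm' _ ⟨g, rfl⟩, hpm'⟩
  have hK := natCard_nsmul_eq_zero_discreteH1_eq (Γ := Hi) (M := M) p hcontHi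
    (exists_nsmul_eq_charModule θ) hinv
  rw [hK]
  -- Step 2 (unramified count) on `B = M[p]`
  haveI : Finite B := finite_torsionBy_charModule (p := p) θ
  have hBp : ∀ b : B, p • b = 0 := fun b ↦
    Subtype.ext (by
      rw [AddSubgroupClass.coe_nsmul, ZeroMemClass.coe_zero]
      exact AddSubgroup.torsionBy.nsmul_iff.mp b.2)
  have hB : ∃ k : ℕ, ∀ b : B, p ^ k • b = 0 := ⟨1, fun b ↦ by rw [pow_one]; exact hBp b⟩
  have hcontB : ∀ b : B, Continuous fun g : G ↦ g • b := fun b ↦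
    (hcont (b : M)).subtype_mk _
  have hunr : ∀ σ ∈ absInertia Fv, ∀ b : B, σ • b = b := fun σ hσ b ↦
    Subtype.ext (by
      rw [AddSubgroup.torsionBy.coe_smul, hsmul]
      exact smul_eq_self_of_apply_eq_one θ (apply_absGaloisRestrict_eq_one_of_isUnramifiedAt θ v hF.1 hσ) _)
  obtain ⟨φ, hφ⟩ := exists_isFrobPow_holds (F := Fv) 1
  obtain ⟨R₀, hR₀⟩ := exists_forall_natCard_subgroupH1_localSubgroup_eq κ hpv hns hB hcontB hunr hφ
  have hcount := hR₀ R₀ le_rfl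
  rw [show Nat.card (discreteH1 (↥Hi) B) =
      Nat.card (Literature.NumberTheory.EllipticCurves.subgroupH1 Hi B) from rfl, hcount]
  -- Step 3: every `b ∈ M[p]` satisfies `φ^{p^R} • b = q^{p^R} • b`
  set q : ℕ := residueFieldCard Fv with hq
  have hcong := sub_mem_maximalIdeal_of_frobActsAsNormAt θ hF hφ
  set u : ℤ_[p]ˣ := unitChar θ (r φ) with hu
  -- `appr u 1 ≡ q (mod p)`
  have hmod : (u : ℤ_[p]).appr 1 ≡ q [MOD p] := by
    have h1 : (u : ℤ_[p]) - ((u : ℤ_[p]).appr 1 : ℕ) ∈ IsLocalRing.maximalIdeal ℤ_[p] := by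
      rw [PadicInt.maximalIdeal_eq_span_p, ← pow_one (p : ℤ_[p])]
      exact PadicInt.appr_spec 1 _
    have h2 : (((u : ℤ_[p]).appr 1 : ℕ) : ℤ_[p]) - (q : ℤ_[p]) ∈ IsLocalRing.maximalIdeal ℤ_[p] := by
      have : (((u : ℤ_[p]).appr 1 : ℕ) : ℤ_[p]) - (q : ℤ_[p]) =
          ((u : ℤ_[p]) - (q : ℤ_[p])) - ((u : ℤ_[p]) - ((u : ℤ_[p]).appr 1 : ℕ)) := by ring
      rw [this]
      exact Ideal.sub_mem _ hcong h1
    rw [← PadicInt.ker_toZMod, RingHom.mem_ker, map_sub, map_natCast, map_natCast, sub_eq_zero] at h2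
    exact (ZMod.natCast_eq_natCast_iff _ _ _).mp h2
  have hall : ∀ b : B, φ ^ p ^ R₀ • b = (q ^ p ^ R₀) • b := by
    intro b
    have hb : p • (b : M) = 0 := AddSubgroup.torsionBy.nsmul_iff.mp b.2
    apply Subtype.ext
    rw [AddSubgroup.torsionBy.coe_smul, AddSubgroupClass.coe_nsmul, hsmul, map_pow,
      pow_prime_pow_smul_eq_smul θ (r φ) (b : M) hb R₀,
      smul_eq_appr_smul_of_prime_nsmul_eq_zero θ (r φ) (b : M) hb,
      CharLocalVanishing.pow_prime_pow_nsmul_eq q R₀ hb]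
    exact nsmul_eq_nsmul_of_modEq hb hmod
  rw [Nat.card_congr (Equiv.subtypeUnivEquiv hall)]
  exact natCard_torsionBy_charModule (p := p) θ

/-! ## §3 `H¹(Gal(K̄_v/K_{∞,w}), (F/𝒪)(θ))` is `p`-divisible; its `ℤ_p`-corank is `1` -/

omit [NumberField K] in
/-- Finite layers of `(F/𝒪)(θ) ≅ ℚ_p/ℤ_p`: `{m : p^k • m = 0}` is finite (of order `p^k`, by
divisibility and `#(·)[p] = p`). [folklore] -/
theorem setOf_pow_nsmul_eq_zero_charModule_finite (k : ℕ) :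
    Set.Finite {m : charModule (∅ : Set (PadicAlgCl p)) θ | p ^ k • m = 0} := by
  have hs : Nat.card {m : charModule (∅ : Set (PadicAlgCl p)) θ // p • m = 0} = p ^ 1 := by
    rw [pow_one]
    exact (Nat.card_congr (Equiv.subtypeEquivRight fun _ ↦
      AddSubgroup.torsionBy.nsmul_iff.symm)).trans (natCard_torsionBy_charModule (p := p) θ)
  have h := natCard_pow_torsion_eq_pow_mul_of_divisible (exists_nsmul_eq_charModule θ) hs k
  have hfin : Finite {m : charModule (∅ : Set (PadicAlgCl p)) θ // p ^ k • m = 0} := by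
    apply Nat.finite_of_card_ne_zero
    rw [h]
    exact pow_ne_zero _ hp.out.ne_zero
  exact Set.finite_coe_iff.mp hfin

/-- **`H¹(Hi, (F/𝒪)(θ))` is `p`-divisible** (`Hi = Gal(K̄_v/K_{∞,w})`, any `ℤ_p`-extension, `v ∤ p`
not split completely in `K_∞`; local action through `absGaloisRestrict`): the module is
`p`-primary, divisible, with finite layers, so the tree's Greenberg–Vatsal Prop. (2.4) module form
`exists_nsmul_eq_subgroupH1_localSubgroup` applies. (The "`μ = 0`" half of KY Lemma 1.1.1.)
[cite: GreenbergVatsal2000, §2 Prop. (2.4) (p. 22)] [cite: KellerYin2024, Lemma 1.1.1 (arXiv:2402.12781v2 TeX L455–462)] -/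
theorem exists_nsmul_eq_subgroupH1_localSubgroup_charModule (κ : ZpExtension K p)
    (hpv : (p : 𝓞 K) ∉ v.asIdeal)
    (hns : ∃ σ : absoluteGaloisGroup (v.adicCompletion K),
      σ ∉ localSubgroup κ.kerSubgroup (v.adicCompletion K)) :
    letI : DistribMulAction (absoluteGaloisGroup (v.adicCompletion K))
        (charModule (∅ : Set (PadicAlgCl p)) θ) :=
      DistribMulAction.compHom _ (absGaloisRestrict K (v.adicCompletion K)).toMonoidHom
    ∀ x : Literature.NumberTheory.EllipticCurves.subgroupH1
        (localSubgroup κ.kerSubgroup (v.adicCompletion K)) (charModule (∅ : Set (PadicAlgCl p)) θ),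
      ∃ x' : Literature.NumberTheory.EllipticCurves.subgroupH1
        (localSubgroup κ.kerSubgroup (v.adicCompletion K)) (charModule (∅ : Set (PadicAlgCl p)) θ),
        p • x' = x := by
  set M := charModule (∅ : Set (PadicAlgCl p)) θ with hM
  letI inst : DistribMulAction (absoluteGaloisGroup (v.adicCompletion K)) M :=
    DistribMulAction.compHom _ (absGaloisRestrict K (v.adicCompletion K)).toMonoidHom
  have hstab := GreenbergSelmer.isOpen_stabilizer_cofree (p := p) (∅ : Set (PadicAlgCl p)) θ
  have hcontK : ∀ m : M, Continuous fun σ : absoluteGaloisGroup K ↦ σ • m := fun m ↦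
    continuous_smul_of_isOpen_stabilizer m (hstab m)
  have hcont : ∀ m : M, Continuous fun g : absoluteGaloisGroup (v.adicCompletion K) ↦ g • m :=
    fun m ↦ (hcontK m).comp (absGaloisRestrict K (v.adicCompletion K)).continuous_toFun
  intro x
  exact exists_nsmul_eq_subgroupH1_localSubgroup κ hpv hns
    (GreenbergSelmer.exists_pow_smul_cofree_eq_zero (∅ : Set (PadicAlgCl p)) θ)
    (exists_nsmul_eq_charModule θ) (setOf_pow_nsmul_eq_zero_charModule_finite θ) hcont x

/-- **`corank_{ℤ_p} H¹(Hi, (F/𝒪)(θ)) = 1`** (`Hi = Gal(K̄_v/K_{∞,w})`) at `v ∤ p` not split completely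
in the `ℤ_p`-extension, for `θ^{p−1} = 1` with `FrobActsAsNormAt ∅ θ v`: the group is `p`-primary
(compact `Hi`, discrete `p`-primary `M`), `p`-divisible (§3) with `#[p] = p` (§2), so
`#[p] = p^{corank}` (`natCard_torsionBy_eq_pow_zpCorank_of_divisible`) gives corank `1` — i.e.
`H¹(K_{∞,w}, (F/𝒪)(θ)) ≅ ℚ_p/ℤ_p`, KY Lemma 1.1.1 per place of `K_∞` ("`λ(𝒫_w(θ)) = [Γ:Γ_w]`",
one unit of corank at each of the `[Γ:Γ_w]` places). [cite: KellerYin2024, Lemma 1.1.1 (arXiv:2402.12781v2 TeX L455–462)]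
[cite: GreenbergVatsal2000, §2 Prop. (2.4) (p. 22)] [cite: CastellaGrossiLeeSkinner2022, Lemma 1.1.1] -/
theorem zpCorank_subgroupH1_localSubgroup_charModule_eq_one (κ : ZpExtension K p)
    (hθ : ∀ σ : absoluteGaloisGroup K, θ σ ^ (p - 1) = 1) (hpv : (p : 𝓞 K) ∉ v.asIdeal)
    (hns : ∃ σ : absoluteGaloisGroup (v.adicCompletion K),
      σ ∉ localSubgroup κ.kerSubgroup (v.adicCompletion K))
    (hF : FrobActsAsNormAt (∅ : Set (PadicAlgCl p)) θ v) :
    letI : DistribMulAction (absoluteGaloisGroup (v.adicCompletion K))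
        (charModule (∅ : Set (PadicAlgCl p)) θ) :=
      DistribMulAction.compHom _ (absGaloisRestrict K (v.adicCompletion K)).toMonoidHom
    zpCorank (Literature.NumberTheory.EllipticCurves.subgroupH1
      (localSubgroup κ.kerSubgroup (v.adicCompletion K)) (charModule (∅ : Set (PadicAlgCl p)) θ)) p =
      1 := by
  set M := charModule (∅ : Set (PadicAlgCl p)) θ with hM
  letI inst : DistribMulAction (absoluteGaloisGroup (v.adicCompletion K)) M :=
    DistribMulAction.compHom _ (absGaloisRestrict K (v.adicCompletion K)).toMonoidHom
  let Fv := v.adicCompletion K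
  let G : Type := absoluteGaloisGroup Fv
  let Hi : Subgroup G := localSubgroup κ.kerSubgroup Fv
  let A : Type := Literature.NumberTheory.EllipticCurves.subgroupH1 Hi M
  haveI : CompactSpace G := absoluteGaloisGroup_compactSpace Fv
  have hHic : IsClosed (Hi : Set G) :=
    κ.isClosed_kerSubgroup.preimage (map_continuous (resGal (K := K) Fv))
  haveI : CompactSpace Hi := isCompact_iff_compactSpace.mp hHic.isCompact
  -- `p`-primary
  have htor : ∀ m : M, ∃ k : ℕ, p ^ k • m = 0 :=
    GreenbergSelmer.exists_pow_smul_cofree_eq_zero (∅ : Set (PadicAlgCl p)) θ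
  have hA : ∀ a : A, ∃ n : ℕ, p ^ n • a = 0 := fun a ↦ by
    obtain ⟨c, rfl⟩ := oneCocycleClass_surjective _ a
    exact IwasawaDual.exists_pow_smul_oneCocycleClass_eq_zero c fun g ↦ htor (c.1 g)
  -- divisible, `#[p] = p`
  have hdiv : ∀ a : A, ∃ b : A, p • b = a :=
    exists_nsmul_eq_subgroupH1_localSubgroup_charModule θ κ hpv hns
  have hcard : Nat.card (A[(p : ℤ)]) = p :=
    (Nat.card_congr (Equiv.subtypeEquivRight fun _ ↦ AddSubgroup.torsionBy.nsmul_iff)).trans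
      (natCard_pTorsion_subgroupH1_localSubgroup_charModule_eq θ κ hθ hpv hns hF)
  haveI : Finite (A[(p : ℤ)]) := Nat.finite_of_card_ne_zero (by rw [hcard]; exact hp.out.ne_zero)
  have h := natCard_torsionBy_eq_pow_zpCorank_of_divisible p hA hdiv
  rw [hcard] at h
  have h1 : p ^ 1 = p ^ zpCorank A p := by rw [pow_one]; exact h
  exact (Nat.pow_right_injective hp.out.two_le h1).symm

end Summit.BirchSwinnertonDyer.BirchSwinnertonDyer.Theorems.CharLocalTameCount

end
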